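import Mathlib
import HarnessLib
import Summits.Ventures.LatticeQCDFlow.Scaling.HeterogeneousUniversality
import Summits.Ventures.LatticeQCDFlow.Scaling.TiltAcceptanceCouplingMonotone
import Summits.Ventures.LatticeQCDFlow.Scaling.LossCouplingInversion

/-!
# LatticeQCDFlow / Scaling — HETEROGENEOUS factorised samplers: the acceptance along every coupling
# sequence, `acc_n(β_n) → erfc(cσ/2)` for `β_n√n → c`, and `→ 1` below the window

HONEST FRAMING: exact (Metropolis-corrected) sampling algorithms for lattice gauge theory;
figures of merit are autocorrelation/cost numbers at stated couplings and volumes; no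
continuum-physics claim.

Venture `LatticeQCDFlow` (cell pub-lqcd), topic `Scaling`; FANOUT row 3 (`s0-u1-a`, S0-B
implementation A, GEN-20).  NEW WORK of the cell — assembly of row 3's GEN-19
`Scaling/HeterogeneousUniversality` (on the exact diagonal `β = c/√n` the acceptance of a row of
independent NON-IDENTICAL bounded centred blocks converges to the log-normal law with `s = c²σ²`,
`σ² = lim n⁻¹ΣᵢVarᵢ`), GEN-17 (A) `Scaling/TiltAcceptanceCouplingMonotone` (acceptance antitone in
`β ≥ 0`, any statistic on any space), the flow seat's dictionary `Scoring/IMHLogNormalAcceptance`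
(`erfc` closed form) and `Scaling/LossCouplingInversion` §0 (continuity of the `erfc` profile);
NO definition is introduced; nothing is cited.

## Content (all `[ours]`): laws `ρ_{n,i}`, statistics `h_{n,i}` (`|h_{n,i}| ≤ K`, centred),
## `T_n = Σᵢ h_{n,i}(yᵢ)` on `(Fin n → Y, ⊗ᵢρ_{n,i})`, `n⁻¹ΣᵢVar h_{n,i} → σ²`

* `heteroPi_meanAccept_le_of_le`, `heteroPi_meanAccept_mem_Icc` — antitone in `β ≥ 0`, `0 ≤ acc ≤ 1`;
* **`heteroPi_meanAccept_diag_tendsto_erfc`** — `c ≠ 0`, `σ² > 0`: on the diagonal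
  `acc_n(c/√n) → (2/√π)∫_{√(c²σ²)/2}^∞ e^{−u²} du = erfc(|c|σ/2)`;
* **`heteroPi_meanAccept_tendsto_of_sqrt_mul_tendsto`** — `β_n√n → c > 0` ⇒ `acc_n(β_n) →
  erfc(cσ/2)` (squeeze between diagonals);
* **`heteroPi_meanAccept_tendsto_one`** — `β_n ≥ 0`, `β_n√n → 0` ⇒ `acc_n(β_n) → 1`.

Reading (value-free): for heterogeneous factorised exact samplers, as for identical blocks, the
large-volume acceptance is a function of `lim β_n√n` alone; the sequel
`Scaling/HeterogeneousLossAcceptance` converts it into a function of the limiting training loss.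
NOT CLAIMED: negative couplings; the `β_n√n → ∞` end (→ 0; same squeeze, omitted); rates; any value
at the cell's `(β, L)`; nothing re-scored.
-/

noncomputable section

namespace Summit.Ventures.LatticeQCDFlow.Theory2

open MeasureTheory ProbabilityTheory Filter Finset Real Set
open scoped Topology NNReal

section Hetero

open Literature.Probability.Distributions.PseudoMarginalNoise

variable {Y : Type*} {mY : MeasurableSpace Y}

/-- The acceptance functional of a heterogeneous row is ANTITONE in `β ≥ 0` (GEN-17 (A) with `q ≡ 1`
on `⊗ᵢρᵢ`). [ours] -/
theorem heteroPi_meanAccept_le_of_le {n : ℕ} (ρ : Fin n → Measure Y) [∀ i, IsProbabilityMeasure (ρ i)]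
    {h : Fin n → Y → ℝ} (hm : ∀ i, Measurable (h i)) {K : ℝ} (hK : ∀ i y, |h i y| ≤ K)
    {β β' : ℝ} (hβ : 0 ≤ β) (hββ' : β ≤ β') :
    (∫ x, ∫ y, min (Real.exp (β' * ∑ i, h i (x i))) (Real.exp (β' * ∑ i, h i (y i)))
          ∂(Measure.pi ρ) ∂(Measure.pi ρ)) / ∫ x, Real.exp (β' * ∑ i, h i (x i)) ∂(Measure.pi ρ)
      ≤ (∫ x, ∫ y, min (Real.exp (β * ∑ i, h i (x i))) (Real.exp (β * ∑ i, h i (y i)))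
          ∂(Measure.pi ρ) ∂(Measure.pi ρ)) / ∫ x, Real.exp (β * ∑ i, h i (x i)) ∂(Measure.pi ρ) := by
  have hTm : Measurable fun y : Fin n → Y => ∑ i, h i (y i) :=
    Finset.measurable_sum _ fun i _ => (hm i).comp (measurable_pi_apply i)
  have hTb : ∀ y : Fin n → Y, |∑ i, h i (y i)| ≤ n * K := fun y => by
    calc |∑ i, h i (y i)| ≤ ∑ i, |h i (y i)| := Finset.abs_sum_le_sum_abs _ _
      _ ≤ ∑ _i : Fin n, K := Finset.sum_le_sum fun i _ => hK i _
      _ = n * K := by simp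
  have hb : ∀ᵐ y ∂(Measure.pi ρ), (∑ i, h i (y i)) ∈ Set.Icc (-(n * K)) (n * K) :=
    ae_of_all _ fun y => abs_le.1 (hTb y)
  have hint : ∀ γ : ℝ, Integrable (fun y : Fin n → Y => (1 : ℝ) * Real.exp (γ * ∑ i, h i (y i)))
      (Measure.pi ρ) := fun γ => by
    simpa using integrable_exp_mul_of_mem_Icc hTm.aemeasurable hb (t := γ)
  have hpos : ∀ γ : ℝ, 0 < ∫ y, (1 : ℝ) * Real.exp (γ * ∑ i, h i (y i)) ∂(Measure.pi ρ) :=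
    fun γ => by simpa using integral_exp_pos (by simpa using hint γ)
  have hle := tiltIMH_meanAccept_le_of_le (ν := Measure.pi ρ) (q := fun _ => (1 : ℝ))
    (T := fun y => ∑ i, h i (y i)) (fun _ => zero_le_one) measurable_const hTm (integrable_const _)
    hβ hββ' (hint β) (hint β') (hpos β) (hpos β')
  simpa using hle

/-- `0 ≤ acc ≤ 1` for the acceptance functional of a heterogeneous row. [ours] -/
theorem heteroPi_meanAccept_mem_Icc {n : ℕ} (ρ : Fin n → Measure Y) [∀ i, IsProbabilityMeasure (ρ i)]
    {h : Fin n → Y → ℝ} (hm : ∀ i, Measurable (h i)) {K : ℝ} (hK : ∀ i y, |h i y| ≤ K) (β : ℝ) :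
    (∫ x, ∫ y, min (Real.exp (β * ∑ i, h i (x i))) (Real.exp (β * ∑ i, h i (y i)))
          ∂(Measure.pi ρ) ∂(Measure.pi ρ)) / ∫ x, Real.exp (β * ∑ i, h i (x i)) ∂(Measure.pi ρ)
      ∈ Set.Icc (0 : ℝ) 1 := by
  set P := Measure.pi ρ with hP
  have hTm : Measurable fun y : Fin n → Y => ∑ i, h i (y i) :=
    Finset.measurable_sum _ fun i _ => (hm i).comp (measurable_pi_apply i)
  have hTb : ∀ y : Fin n → Y, |∑ i, h i (y i)| ≤ n * K := fun y => by
    calc |∑ i, h i (y i)| ≤ ∑ i, |h i (y i)| := Finset.abs_sum_le_sum_abs _ _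
      _ ≤ ∑ _i : Fin n, K := Finset.sum_le_sum fun i _ => hK i _
      _ = n * K := by simp
  have hb : ∀ᵐ y ∂P, (∑ i, h i (y i)) ∈ Set.Icc (-(n * K)) (n * K) := ae_of_all _ fun y => abs_le.1 (hTb y)
  have hint : Integrable (fun y : Fin n → Y => Real.exp (β * ∑ i, h i (y i))) P :=
    integrable_exp_mul_of_mem_Icc hTm.aemeasurable hb
  have hZ : 0 < ∫ y, Real.exp (β * ∑ i, h i (y i)) ∂P := integral_exp_pos hint
  have hnum0 : 0 ≤ ∫ x, ∫ y, min (Real.exp (β * ∑ i, h i (x i))) (Real.exp (β * ∑ i, h i (y i))) ∂P ∂P :=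
    integral_nonneg fun x => integral_nonneg fun y => (lt_min (Real.exp_pos _) (Real.exp_pos _)).le
  have hnum1 : ∫ x, ∫ y, min (Real.exp (β * ∑ i, h i (x i))) (Real.exp (β * ∑ i, h i (y i))) ∂P ∂P
      ≤ ∫ x, Real.exp (β * ∑ i, h i (x i)) ∂P := by
    refine integral_mono_of_nonneg (ae_of_all _ fun x => integral_nonneg fun y =>
      (lt_min (Real.exp_pos _) (Real.exp_pos _)).le) hint (ae_of_all _ fun x => ?_)
    calc ∫ y, min (Real.exp (β * ∑ i, h i (x i))) (Real.exp (β * ∑ i, h i (y i))) ∂P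
        ≤ ∫ _y, Real.exp (β * ∑ i, h i (x i)) ∂P :=
          integral_mono_of_nonneg (ae_of_all _ fun y => (lt_min (Real.exp_pos _) (Real.exp_pos _)).le)
            (integrable_const _) (ae_of_all _ fun y => min_le_left _ _)
      _ = Real.exp (β * ∑ i, h i (x i)) := by simp
  exact ⟨div_nonneg hnum0 hZ.le, (div_le_one hZ).2 hnum1⟩

variable {ρ : (n : ℕ) → Fin n → Measure Y} [∀ n i, IsProbabilityMeasure (ρ n i)]
  {h : (n : ℕ) → Fin n → Y → ℝ}

/-- **The diagonal profile of a heterogeneous row is `erfc(|c|σ/2)`** (`c ≠ 0`, `σ² > 0`): the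
log-normal limit of `Scaling/HeterogeneousUniversality` in the dictionary's closed form. [ours] -/
theorem heteroPi_meanAccept_diag_tendsto_erfc (hm : ∀ n i, Measurable (h n i)) {K : ℝ}
    (hK : ∀ n i y, |h n i y| ≤ K) (h0 : ∀ n i, ∫ y, h n i y ∂ρ n i = 0) {σ2 : ℝ} (hσ2 : 0 < σ2)
    (hσ : Tendsto (fun n : ℕ => (∑ i, Var[h n i; ρ n i]) / n) atTop (𝓝 σ2)) {c : ℝ} (hc : c ≠ 0) :
    Tendsto (fun n : ℕ =>
        (∫ x, ∫ y, min (Real.exp (c / Real.sqrt n * ∑ i, h n i (x i)))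
              (Real.exp (c / Real.sqrt n * ∑ i, h n i (y i)))
            ∂(Measure.pi (ρ n)) ∂(Measure.pi (ρ n)))
          / ∫ x, Real.exp (c / Real.sqrt n * ∑ i, h n i (x i)) ∂(Measure.pi (ρ n)))
      atTop (𝓝 (2 / Real.sqrt Real.pi
        * ∫ u in Ioi (Real.sqrt (c ^ 2 * σ2) / 2), Real.exp (-u ^ 2))) := by
  have hpos : 0 < c ^ 2 * σ2 := mul_pos (by positivity) hσ2
  have hs : (c ^ 2 * σ2).toNNReal ≠ 0 := fun h' => absurd (Real.toNNReal_eq_zero.1 h') (not_le.2 hpos)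
  have h := heteroPi_meanAccept_tendsto hm hK h0 hσ c
  rw [Scoring.imh_lognormal_accRate_eq_erfc hs, Real.coe_toNNReal _ hpos.le] at h
  exact h

/-- **THE ACCEPTANCE OF A HETEROGENEOUS ROW ALONG EVERY COUPLING SEQUENCE**: `β_n√n → c > 0` ⇒
`acc_n(β_n) → (2/√π)∫_{√(c²σ²)/2}^∞ e^{−u²} du = erfc(cσ/2)`. [ours] -/
theorem heteroPi_meanAccept_tendsto_of_sqrt_mul_tendsto (hm : ∀ n i, Measurable (h n i)) {K : ℝ}
    (hK : ∀ n i y, |h n i y| ≤ K) (h0 : ∀ n i, ∫ y, h n i y ∂ρ n i = 0) {σ2 : ℝ} (hσ2 : 0 < σ2)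
    (hσ : Tendsto (fun n : ℕ => (∑ i, Var[h n i; ρ n i]) / n) atTop (𝓝 σ2)) {β : ℕ → ℝ} {c : ℝ}
    (hc : 0 < c) (hβ : Tendsto (fun n : ℕ => β n * Real.sqrt n) atTop (𝓝 c)) :
    Tendsto (fun n : ℕ =>
        (∫ x, ∫ y, min (Real.exp (β n * ∑ i, h n i (x i))) (Real.exp (β n * ∑ i, h n i (y i)))
            ∂(Measure.pi (ρ n)) ∂(Measure.pi (ρ n)))
          / ∫ x, Real.exp (β n * ∑ i, h n i (x i)) ∂(Measure.pi (ρ n)))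
      atTop (𝓝 (2 / Real.sqrt Real.pi
        * ∫ u in Ioi (Real.sqrt (c ^ 2 * σ2) / 2), Real.exp (-u ^ 2))) := by
  set Pf : ℝ → ℝ := fun c' => 2 / Real.sqrt Real.pi
      * ∫ u in Ioi (Real.sqrt (c' ^ 2 * σ2) / 2), Real.exp (-u ^ 2) with hPf
  have hPc : ContinuousAt Pf c := (continuous_erfcProfile σ2).continuousAt
  have hβpos : ∀ᶠ n : ℕ in atTop, 0 ≤ β n := by
    filter_upwards [(tendsto_order.1 hβ).1 (c / 2) (by linarith), eventually_gt_atTop 0]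
      with n hn hn0
    have hsn : 0 < Real.sqrt n := Real.sqrt_pos.2 (Nat.cast_pos.2 hn0)
    by_contra hneg
    push Not at hneg
    have : β n * Real.sqrt n ≤ 0 := mul_nonpos_of_nonpos_of_nonneg hneg.le hsn.le
    linarith
  rw [tendsto_order]
  refine ⟨fun a ha => ?_, fun b hb => ?_⟩
  · obtain ⟨δ, hδ, hball⟩ := Metric.eventually_nhds_iff.1 ((tendsto_order.1 hPc.tendsto).1 a ha)
    set c' : ℝ := c + δ / 2 with hc'
    have hc'0 : 0 < c' := by rw [hc']; linarith
    have hPc' : a < Pf c' := hball (by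
      rw [Real.dist_eq, hc', add_sub_cancel_left, abs_of_pos (by linarith)]; linarith)
    have hdiag := heteroPi_meanAccept_diag_tendsto_erfc hm hK h0 hσ2 hσ hc'0.ne'
    have hev1 := (tendsto_order.1 hdiag).1 a hPc'
    have hev2 : ∀ᶠ n : ℕ in atTop, β n ≤ c' / Real.sqrt n := by
      filter_upwards [(tendsto_order.1 hβ).2 c' (by rw [hc']; linarith), eventually_gt_atTop 0]
        with n hn hn0
      have hsn : 0 < Real.sqrt n := Real.sqrt_pos.2 (Nat.cast_pos.2 hn0)
      rw [le_div_iff₀ hsn]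
      exact hn.le
    filter_upwards [hev1, hev2, hβpos] with n h1 h2 h3
    exact h1.trans_le (heteroPi_meanAccept_le_of_le (ρ n) (hm n) (hK n) h3 h2)
  · obtain ⟨δ, hδ, hball⟩ := Metric.eventually_nhds_iff.1 ((tendsto_order.1 hPc.tendsto).2 b hb)
    set η : ℝ := min δ c / 2 with hη
    have hη0 : 0 < η := by rw [hη]; positivity
    have hηδ : η < δ := by
      rw [hη]; have := min_le_left δ c; linarith
    have hηc : η < c := by
      rw [hη]; have := min_le_right δ c; linarith
    set c' : ℝ := c - η with hc'
    have hc'0 : 0 < c' := by rw [hc']; linarith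
    have hPc' : Pf c' < b := hball (by
      rw [Real.dist_eq, hc', show c - η - c = -η by ring, abs_neg, abs_of_pos hη0]; exact hηδ)
    have hdiag := heteroPi_meanAccept_diag_tendsto_erfc hm hK h0 hσ2 hσ hc'0.ne'
    have hev1 := (tendsto_order.1 hdiag).2 b hPc'
    have hev2 : ∀ᶠ n : ℕ in atTop, c' / Real.sqrt n ≤ β n := by
      filter_upwards [(tendsto_order.1 hβ).1 c' (by rw [hc']; linarith), eventually_gt_atTop 0]
        with n hn hn0
      have hsn : 0 < Real.sqrt n := Real.sqrt_pos.2 (Nat.cast_pos.2 hn0)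
      rw [div_le_iff₀ hsn]
      exact hn.le
    filter_upwards [hev1, hev2, eventually_gt_atTop 0] with n h1 h2 hn0
    have hcn : 0 ≤ c' / Real.sqrt n := div_nonneg hc'0.le (Real.sqrt_nonneg _)
    exact (heteroPi_meanAccept_le_of_le (ρ n) (hm n) (hK n) hcn h2).trans_lt h1

/-- **BELOW THE WINDOW, heterogeneous row**: `β_n ≥ 0`, `β_n√n → 0` ⇒ `acc_n(β_n) → 1`. [ours] -/
theorem heteroPi_meanAccept_tendsto_one (hm : ∀ n i, Measurable (h n i)) {K : ℝ}
    (hK : ∀ n i y, |h n i y| ≤ K) (h0 : ∀ n i, ∫ y, h n i y ∂ρ n i = 0) {σ2 : ℝ} (hσ2 : 0 < σ2)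
    (hσ : Tendsto (fun n : ℕ => (∑ i, Var[h n i; ρ n i]) / n) atTop (𝓝 σ2)) {β : ℕ → ℝ}
    (hβ0 : ∀ n, 0 ≤ β n) (hβ : Tendsto (fun n : ℕ => β n * Real.sqrt n) atTop (𝓝 0)) :
    Tendsto (fun n : ℕ =>
        (∫ x, ∫ y, min (Real.exp (β n * ∑ i, h n i (x i))) (Real.exp (β n * ∑ i, h n i (y i)))
            ∂(Measure.pi (ρ n)) ∂(Measure.pi (ρ n)))
          / ∫ x, Real.exp (β n * ∑ i, h n i (x i)) ∂(Measure.pi (ρ n)))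
      atTop (𝓝 1) := by
  set Pf : ℝ → ℝ := fun c' => 2 / Real.sqrt Real.pi
      * ∫ u in Ioi (Real.sqrt (c' ^ 2 * σ2) / 2), Real.exp (-u ^ 2) with hPf
  have hP0 : Pf 0 = 1 := by
    simp only [hPf, ne_eq, OfNat.ofNat_ne_zero, not_false_eq_true, zero_pow, zero_mul,
      Real.sqrt_zero, zero_div]
    exact erfcProfile_zero
  have hPc : ContinuousAt Pf 0 := (continuous_erfcProfile σ2).continuousAt
  rw [tendsto_order]
  refine ⟨fun a ha => ?_, fun b hb => Filter.Eventually.of_forall fun n =>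
    (heteroPi_meanAccept_mem_Icc (ρ n) (hm n) (hK n) (β n)).2.trans_lt hb⟩
  have ha' : a < Pf 0 := by rw [hP0]; exact ha
  obtain ⟨δ, hδ, hball⟩ := Metric.eventually_nhds_iff.1 ((tendsto_order.1 hPc.tendsto).1 a ha')
  set c' : ℝ := δ / 2 with hc'
  have hc'0 : 0 < c' := by rw [hc']; linarith
  have hPc' : a < Pf c' := hball (by rw [Real.dist_eq, sub_zero, abs_of_pos hc'0, hc']; linarith)
  have hdiag := heteroPi_meanAccept_diag_tendsto_erfc hm hK h0 hσ2 hσ hc'0.ne'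
  have hev1 := (tendsto_order.1 hdiag).1 a hPc'
  have hev2 : ∀ᶠ n : ℕ in atTop, β n ≤ c' / Real.sqrt n := by
    filter_upwards [(tendsto_order.1 hβ).2 c' hc'0, eventually_gt_atTop 0] with n hn hn0
    have hsn : 0 < Real.sqrt n := Real.sqrt_pos.2 (Nat.cast_pos.2 hn0)
    rw [le_div_iff₀ hsn]
    exact hn.le
  filter_upwards [hev1, hev2] with n h1 h2
  exact h1.trans_le (heteroPi_meanAccept_le_of_le (ρ n) (hm n) (hK n) (hβ0 n) h2)

end Hetero

end Summit.Ventures.LatticeQCDFlow.Theory2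

end
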